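import Summits.CriticalPhenomena.PercolationContinuityZ3.Theorems.Transplant.FKConnectivityAllQForestTreeLevelTools
import Summits.CriticalPhenomena.PercolationContinuityZ3.Theorems.Transplant.FKConnectivityAllQForestTriangleClaw
import HarnessLib

/-!
# Tree level of the square-free adjacent forest Rayleigh node, part 2/5: the PAIR CELLS of a vertex elimination

Support file (`--supports stmt-CriticalPhenomena-4575`), FK sub-lane `prim-bschramm-fk-1` (generation 29) of the post-continuity
programme; builds on p205010 (kernel theorem, internal audit signed; external expert review pending).  No definitions, no named facts,
no sorries; standard axioms.  Parts: `…ForestTreeLevelTools` (1), this file (2), `…ForestTreeLevelSteps` (3),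
`…ForestTreeLevelFar` (4), `…ForestTreeLevel` (5: the theorem `adjForestNoSq_fibre_of_tight`).

When a far vertex `z` of a tight fibre is eliminated (claw / mixed step), the surviving cells are counts on the rest `(M', u₀)` (one
vertex down, NEAR-tight: `2|T| ≤ |M'| + 2|u₀| + 3`) in which one class separates a pair `p, q` of former neighbours of `z`.
**`treeLevel_pairCell_le`**: GIVEN the tree-level inequality for every tight fibre inside `T` (the induction hypothesis), the two
`bad` cells at `pq` are at most the two `good` cells — `pq` pinned: both empty; `pq` new: the two cells add up to the tight fibre
`(M' ∪ {pq}, u₀)` (`fibreCount_forest_sep_add_of_notMem`); `pq` free: each cell is the pinned tight fibre `(M' ∖ {pq}, u₀ ∪ {pq})`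
(`fibreCount_forest_sep_of_mem`), and for `pq = e` or `pq = f` the `bad` and `good` cells coincide (Cibulka–Hladký–LaCroix–Wagner's
parallel new edge).  Helper: `mk_ne_of_far` (blindness of the node's events via g23's `insert_mem_pairEv_iff` / `insert_mem_pairEv₂_iff`).
[cite: CibulkaHladkyLaCroixWagner2008, Thm. 1 (p. 2), Case 3, Table 1 (p. 5)] [cite: Linusson2011, Prop. 2.6] [cite: Grimmett2006, §1.5 (p. 13)]
-/

noncomputable section

namespace Summit.CriticalPhenomena.PercolationContinuityZ3.Theorems
namespace FK

open MeasureTheory Set Literature.Probability.LatticeModels Literature.Probability.Percolation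
open scoped Classical symmDiff

variable {V : Type*} [Fintype V]

/-! ### Small helpers -/

section Helpers

variable {o v y : V}

omit [Fintype V] in
/-- A pair at `z` is neither `e = ov` nor `f = oy` when `z ∉ {o, v, y}`. [folklore] -/
theorem mk_ne_of_far {z a : V} (hzo : z ≠ o) (hzv : z ≠ v) : s(z, a) ≠ s(o, v) := fun h => by
  rcases Sym2.eq_iff.1 h with ⟨h1, _⟩ | ⟨h1, _⟩
  · exact hzo h1
  · exact hzv h1

end Helpers

/-! ### The pair cells of a vertex elimination are tight fibres one vertex down -/

section PairCell

variable {M' u₀ : BondConfig V} {T : Finset V} {o v y p q : V}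

/-- **Pair cells.**  On a near-tight rest `(M', u₀)` inside `T` (`2|T| ≤ |M'| + 2|u₀| + 3`, `e, f ∈ M'` free), for `p ≠ q` in `T`,
the two cells "one class separates `p, q`" of `bad` are at most those of `good`, GIVEN the tree-level inequality for every tight
fibre inside `T` (the induction hypothesis): if `pq` is pinned both cells are empty; if `pq` is not a pair of the rest the two cells
add up to the count on the tight fibre `(M' ∪ {pq}, u₀)`; if `pq` is a free pair of the rest each cell is the count on the tight
fibre `(M' ∖ {pq}, u₀ ∪ {pq})` (and for `pq = e` or `pq = f` the `bad` and `good` cells coincide).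
[cite: CibulkaHladkyLaCroixWagner2008, Case 3, Table 1 (p. 5)] [cite: Linusson2011, Prop. 2.6] -/
theorem treeLevel_pairCell_le
    (IHT : ∀ (N u : BondConfig V), Disjoint u N → (∀ g ∈ N ∪ u, ∀ w ∈ g, w ∈ T) →
      2 * T.card ≤ N.ncard + 2 * u.ncard + 2 →
      fibreCount N u (forestEv V ∩ {ω | s(o, v) ∈ ω ∧ s(o, y) ∈ ω}) (forestEv V) ≤
        fibreCount N u (forestEv V ∩ {ω | s(o, v) ∈ ω}) (forestEv V ∩ {ω | s(o, y) ∈ ω}))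
    (hd : Disjoint u₀ M') (hT : ∀ g ∈ M' ∪ u₀, ∀ w ∈ g, w ∈ T) (hnt : 2 * T.card ≤ M'.ncard + 2 * u₀.ncard + 3)
    (he : s(o, v) ∈ M') (hf : s(o, y) ∈ M') (hvy : v ≠ y) (hp : p ∈ T) (hq : q ∈ T) (hpq : p ≠ q) :
    fibreCount M' u₀ (forestEv V ∩ {ω | ¬ (openGraph ω).Reachable p q} ∩ {ω | s(o, v) ∈ ω ∧ s(o, y) ∈ ω}) (forestEv V ∩ univ) +
        fibreCount M' u₀ (forestEv V ∩ {ω | s(o, v) ∈ ω ∧ s(o, y) ∈ ω}) (forestEv V ∩ {ω | ¬ (openGraph ω).Reachable p q} ∩ univ) ≤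
      fibreCount M' u₀ (forestEv V ∩ {ω | ¬ (openGraph ω).Reachable p q} ∩ {ω | s(o, v) ∈ ω}) (forestEv V ∩ {ω | s(o, y) ∈ ω}) +
        fibreCount M' u₀ (forestEv V ∩ {ω | s(o, v) ∈ ω}) (forestEv V ∩ {ω | ¬ (openGraph ω).Reachable p q} ∩ {ω | s(o, y) ∈ ω}) := by
  have hef : s(o, v) ≠ s(o, y) := fun h' => hvy (Sym2.congr_right.1 h')
  by_cases hgu : s(p, q) ∈ u₀
  · -- pinned pair: both `bad` cells are empty
    rw [fibreCount_forest_sep_eq_zero_of_mem_pinned hpq hgu, fibreCount_forest_sep_eq_zero_of_mem_pinned' hpq hgu]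
    exact Nat.zero_le _
  by_cases hgM : s(p, q) ∈ M'
  · -- a free pair of the rest: write `M' = M'' ∪ {pq}`
    obtain ⟨M'', hgM'', rfl⟩ : ∃ M'', s(p, q) ∉ M'' ∧ M' = insert s(p, q) M'' :=
      ⟨M' \ {s(p, q)}, by simp, by rw [insert_sdiff_singleton, insert_eq_of_mem hgM]⟩
    have hd' : Disjoint (insert s(p, q) u₀) M'' := by
      rw [Set.disjoint_insert_left]
      exact ⟨hgM'', Disjoint.mono_right (subset_insert _ _) hd⟩
    have hT' : ∀ g ∈ M'' ∪ insert s(p, q) u₀, ∀ w ∈ g, w ∈ T := by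
      intro g hg w hw
      rcases hg with hg | hg
      · exact hT g (Or.inl (mem_insert_of_mem _ hg)) w hw
      · rcases mem_insert_iff.1 hg with rfl | hg
        · exact hT _ (Or.inl (mem_insert _ _)) w hw
        · exact hT g (Or.inr hg) w hw
    have hcard1 : (insert s(p, q) M'').ncard = M''.ncard + 1 := ncard_insert_of_notMem hgM'' (toFinite _)
    have hcard2 : (insert s(p, q) u₀).ncard = u₀.ncard + 1 := ncard_insert_of_notMem hgu (toFinite _)
    have ht' : 2 * T.card ≤ M''.ncard + 2 * (insert s(p, q) u₀).ncard + 2 := by rw [hcard2]; rw [hcard1] at hnt; omega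
    by_cases hge : s(p, q) = s(o, v)
    · -- `pq = e`: the configuration-side cells are empty, the partner-side cells coincide
      have hreach : ∀ {ω : BondConfig V}, s(o, v) ∈ ω → (openGraph ω).Reachable p q := fun {ω} h =>
        ((openGraph_adj _ _ _).2 ⟨hge ▸ h, hpq⟩).reachable
      have z1 : fibreCount (insert s(p, q) M'') u₀
          (forestEv V ∩ {ω | ¬ (openGraph ω).Reachable p q} ∩ {ω | s(o, v) ∈ ω ∧ s(o, y) ∈ ω}) (forestEv V ∩ univ) = 0 :=
        fibreCount_eq_zero_of_forall _ _ _ _ fun ω _ hA _ => hA.1.2 (hreach hA.2.1)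
      have z2 : fibreCount (insert s(p, q) M'') u₀
          (forestEv V ∩ {ω | ¬ (openGraph ω).Reachable p q} ∩ {ω | s(o, v) ∈ ω}) (forestEv V ∩ {ω | s(o, y) ∈ ω}) = 0 :=
        fibreCount_eq_zero_of_forall _ _ _ _ fun ω _ hA _ => hA.1.2 (hreach hA.2)
      have heM : s(o, v) ∈ insert s(p, q) M'' := hge ▸ mem_insert _ _
      have hfq : ∀ ω, insert s(p, q) ω ∈ {ω : BondConfig V | s(o, y) ∈ ω} ↔ ω ∈ {ω : BondConfig V | s(o, y) ∈ ω} :=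
        insert_mem_pairEv_iff (hge ▸ hef)
      have huniv : ∀ ω, insert s(p, q) ω ∈ (univ : Set (BondConfig V)) ↔ ω ∈ (univ : Set (BondConfig V)) := fun _ => by simp
      -- both partner-side cells equal `X := #_{(M'', u₀ ∪ {e})}(Fo, Fo ∩ {f})`
      have c1 : fibreCount (insert s(p, q) M'') u₀ (forestEv V ∩ {ω | s(o, v) ∈ ω ∧ s(o, y) ∈ ω})
          (forestEv V ∩ {ω | ¬ (openGraph ω).Reachable p q} ∩ univ) =
          fibreCount M'' (insert s(p, q) u₀) (forestEv V ∩ univ) (forestEv V ∩ {ω | s(o, y) ∈ ω}) := by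
        rw [fibreCount_swap, ← fibreCount_forest_sep_of_mem hpq hgM'' hgu huniv hfq]
        refine fibreCount_congr_fibre _ _ fun ω hω => ?_
        constructor
        · rintro ⟨hA, hB⟩; exact ⟨hA, hB.1, hB.2.2⟩
        · rintro ⟨hA, hB⟩
          exact ⟨hA, hB.1, (mem_symmDiff_iff_not_mem heM).2 fun h => hA.1.2 (hreach h), hB.2⟩
      have c2 : fibreCount (insert s(p, q) M'') u₀ (forestEv V ∩ {ω | s(o, v) ∈ ω})
          (forestEv V ∩ {ω | ¬ (openGraph ω).Reachable p q} ∩ {ω | s(o, y) ∈ ω}) =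
          fibreCount M'' (insert s(p, q) u₀) (forestEv V ∩ univ) (forestEv V ∩ {ω | s(o, y) ∈ ω}) := by
        rw [fibreCount_swap, fibreCount_swap M'', ← fibreCount_forest_sep_of_mem hpq hgM'' hgu hfq huniv]
        refine fibreCount_congr_fibre _ _ fun ω hω => ?_
        constructor
        · rintro ⟨hA, hB⟩; exact ⟨hA, hB.1, mem_univ _⟩
        · rintro ⟨hA, hB⟩
          exact ⟨hA, hB.1, (mem_symmDiff_iff_not_mem heM).2 fun h => hA.1.2 (hreach h)⟩
      simp only [z1, z2, c1, c2, zero_add, le_refl]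
    by_cases hgf : s(p, q) = s(o, y)
    · -- `pq = f`: symmetric
      have hreach : ∀ {ω : BondConfig V}, s(o, y) ∈ ω → (openGraph ω).Reachable p q := fun {ω} h =>
        ((openGraph_adj _ _ _).2 ⟨hgf ▸ h, hpq⟩).reachable
      have z1 : fibreCount (insert s(p, q) M'') u₀
          (forestEv V ∩ {ω | ¬ (openGraph ω).Reachable p q} ∩ {ω | s(o, v) ∈ ω ∧ s(o, y) ∈ ω}) (forestEv V ∩ univ) = 0 :=
        fibreCount_eq_zero_of_forall _ _ _ _ fun ω _ hA _ => hA.1.2 (hreach hA.2.2)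
      have z2 : fibreCount (insert s(p, q) M'') u₀ (forestEv V ∩ {ω | s(o, v) ∈ ω})
          (forestEv V ∩ {ω | ¬ (openGraph ω).Reachable p q} ∩ {ω | s(o, y) ∈ ω}) = 0 :=
        fibreCount_eq_zero_of_forall _ _ _ _ fun ω _ _ hB => hB.1.2 (hreach hB.2)
      have hfM : s(o, y) ∈ insert s(p, q) M'' := hgf ▸ mem_insert _ _
      have heq : ∀ ω, insert s(p, q) ω ∈ {ω : BondConfig V | s(o, v) ∈ ω} ↔ ω ∈ {ω : BondConfig V | s(o, v) ∈ ω} :=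
        insert_mem_pairEv_iff (hgf ▸ hef.symm)
      have huniv : ∀ ω, insert s(p, q) ω ∈ (univ : Set (BondConfig V)) ↔ ω ∈ (univ : Set (BondConfig V)) := fun _ => by simp
      -- both surviving cells equal `Y := #_{(M'', u₀ ∪ {f})}(Fo, Fo ∩ {e})`
      have c1 : fibreCount (insert s(p, q) M'') u₀ (forestEv V ∩ {ω | s(o, v) ∈ ω ∧ s(o, y) ∈ ω})
          (forestEv V ∩ {ω | ¬ (openGraph ω).Reachable p q} ∩ univ) =
          fibreCount M'' (insert s(p, q) u₀) (forestEv V ∩ univ) (forestEv V ∩ {ω | s(o, v) ∈ ω}) := by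
        rw [fibreCount_swap, ← fibreCount_forest_sep_of_mem hpq hgM'' hgu huniv heq]
        refine fibreCount_congr_fibre _ _ fun ω hω => ?_
        constructor
        · rintro ⟨hA, hB⟩; exact ⟨hA, hB.1, hB.2.1⟩
        · rintro ⟨hA, hB⟩
          exact ⟨hA, hB.1, hB.2, (mem_symmDiff_iff_not_mem hfM).2 fun h => hA.1.2 (hreach h)⟩
      have c2 : fibreCount (insert s(p, q) M'') u₀
          (forestEv V ∩ {ω | ¬ (openGraph ω).Reachable p q} ∩ {ω | s(o, v) ∈ ω}) (forestEv V ∩ {ω | s(o, y) ∈ ω}) =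
          fibreCount M'' (insert s(p, q) u₀) (forestEv V ∩ univ) (forestEv V ∩ {ω | s(o, v) ∈ ω}) := by
        rw [fibreCount_swap M'', ← fibreCount_forest_sep_of_mem hpq hgM'' hgu heq huniv]
        refine fibreCount_congr_fibre _ _ fun ω hω => ?_
        constructor
        · rintro ⟨hA, hB⟩; exact ⟨hA, hB.1, mem_univ _⟩
        · rintro ⟨hA, hB⟩
          exact ⟨hA, hB.1, (mem_symmDiff_iff_not_mem hfM).2 fun h => hA.1.2 (hreach h)⟩
      simp only [z1, z2, c1, c2, zero_add, add_zero, le_refl]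
    -- a free pair other than `e, f`: each cell is the pinned tight fibre
    have hbl : ∀ ω, insert s(p, q) ω ∈ {ω : BondConfig V | s(o, v) ∈ ω ∧ s(o, y) ∈ ω} ↔
        ω ∈ {ω : BondConfig V | s(o, v) ∈ ω ∧ s(o, y) ∈ ω} := insert_mem_pairEv₂_iff hge hgf
    have hble : ∀ ω, insert s(p, q) ω ∈ {ω : BondConfig V | s(o, v) ∈ ω} ↔ ω ∈ {ω : BondConfig V | s(o, v) ∈ ω} :=
      insert_mem_pairEv_iff hge
    have hblf : ∀ ω, insert s(p, q) ω ∈ {ω : BondConfig V | s(o, y) ∈ ω} ↔ ω ∈ {ω : BondConfig V | s(o, y) ∈ ω} :=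
      insert_mem_pairEv_iff hgf
    have huniv : ∀ ω, insert s(p, q) ω ∈ (univ : Set (BondConfig V)) ↔ ω ∈ (univ : Set (BondConfig V)) := fun _ => by simp
    have c1 := fibreCount_forest_sep_of_mem hpq hgM'' hgu hbl huniv
    have c2 : fibreCount (insert s(p, q) M'') u₀ (forestEv V ∩ {ω | s(o, v) ∈ ω ∧ s(o, y) ∈ ω})
        (forestEv V ∩ {ω | ¬ (openGraph ω).Reachable p q} ∩ univ) =
        fibreCount M'' (insert s(p, q) u₀) (forestEv V ∩ {ω | s(o, v) ∈ ω ∧ s(o, y) ∈ ω}) (forestEv V ∩ univ) := by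
      rw [fibreCount_swap, fibreCount_forest_sep_of_mem hpq hgM'' hgu huniv hbl, fibreCount_swap]
    have c3 := fibreCount_forest_sep_of_mem hpq hgM'' hgu hble hblf
    have c4 : fibreCount (insert s(p, q) M'') u₀ (forestEv V ∩ {ω | s(o, v) ∈ ω})
        (forestEv V ∩ {ω | ¬ (openGraph ω).Reachable p q} ∩ {ω | s(o, y) ∈ ω}) =
        fibreCount M'' (insert s(p, q) u₀) (forestEv V ∩ {ω | s(o, v) ∈ ω}) (forestEv V ∩ {ω | s(o, y) ∈ ω}) := by
      rw [fibreCount_swap, fibreCount_forest_sep_of_mem hpq hgM'' hgu hblf hble, fibreCount_swap]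
    have IH' := IHT M'' (insert s(p, q) u₀) hd' hT' ht'
    rw [c1, c2, c3, c4, inter_univ]
    omega
  · -- a new pair: the two cells add up to the merged tight fibre
    have hge : s(p, q) ≠ s(o, v) := fun h => hgM (h ▸ he)
    have hgf : s(p, q) ≠ s(o, y) := fun h => hgM (h ▸ hf)
    have hbl : ∀ ω, insert s(p, q) ω ∈ {ω : BondConfig V | s(o, v) ∈ ω ∧ s(o, y) ∈ ω} ↔
        ω ∈ {ω : BondConfig V | s(o, v) ∈ ω ∧ s(o, y) ∈ ω} := insert_mem_pairEv₂_iff hge hgf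
    have hble : ∀ ω, insert s(p, q) ω ∈ {ω : BondConfig V | s(o, v) ∈ ω} ↔ ω ∈ {ω : BondConfig V | s(o, v) ∈ ω} :=
      insert_mem_pairEv_iff hge
    have hblf : ∀ ω, insert s(p, q) ω ∈ {ω : BondConfig V | s(o, y) ∈ ω} ↔ ω ∈ {ω : BondConfig V | s(o, y) ∈ ω} :=
      insert_mem_pairEv_iff hgf
    have huniv : ∀ ω, insert s(p, q) ω ∈ (univ : Set (BondConfig V)) ↔ ω ∈ (univ : Set (BondConfig V)) := fun _ => by simp
    rw [fibreCount_forest_sep_add_of_notMem hpq hgM hgu hbl huniv, fibreCount_forest_sep_add_of_notMem hpq hgM hgu hble hblf]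
    have hd' : Disjoint u₀ (insert s(p, q) M') := Set.disjoint_insert_right.2 ⟨hgu, hd⟩
    have hT' : ∀ g ∈ insert s(p, q) M' ∪ u₀, ∀ w ∈ g, w ∈ T := by
      intro g hg w hw
      rcases hg with hg | hg
      · rcases mem_insert_iff.1 hg with rfl | hg
        · rcases Sym2.mem_iff.1 hw with rfl | rfl
          · exact hp
          · exact hq
        · exact hT g (Or.inl hg) w hw
      · exact hT g (Or.inr hg) w hw
    have hcard : (insert s(p, q) M').ncard = M'.ncard + 1 := ncard_insert_of_notMem hgM (toFinite _)
    have IH' := IHT (insert s(p, q) M') u₀ hd' hT' (by rw [hcard]; omega)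
    rw [inter_univ]
    exact IH'

end PairCell

end FK
end Summit.CriticalPhenomena.PercolationContinuityZ3.Theorems

end
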